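import Summits.Langlands.Langlands.Theses.QuarterDeficit1951

/-!
# Route `QuarterDeficit1951` (Langlands) — assembly item `Assembly` (stmt-Langlands-15900)

Settles the assembly item of the refutation-shaped route `QuarterDeficit1951`:

  `Assembly := QuarterFingerprintDeficit → CorrespondentFingerprint → IcosahedralSupply → ¬ Langlands`.

This is pure logic (D-0019 thin route, D-0027 refutation shape): the implication is, literally, the
type of the route's deciding theorem
`Summit.Langlands.Langlands.Theses.QuarterDeficit1951.closes` — assume `Langlands`, specialise to
`F = ℚ`, take the even icosahedral supply `(ι, ρ)` at `ℓ = 17` from `IcosahedralSupply`, run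
conjunct (B) of the summit at `n = 2` to get a cuspidal L-algebraic correspondent `π`, turn it into a
fingerprinted `λ = 1/4` Maass newform with `CorrespondentFingerprint`, and contradict
`QuarterFingerprintDeficit` (exact fingerprint membership is within `1/100`, and `λ = 1/4` lies in the
window).  The theorem below is stated against the route decl BY NAME so that the gate can close the
item; no mathematical content lives here — the content of the route is the certified census
`QuarterFingerprintDeficit` (rank 2), the dictionary `CorrespondentFingerprint` (rank 3) and the
Doud–Moore supply `IcosahedralSupply` (rank 9).
-/

set_option linter.dupNamespace false -- project-wide option (lakefile weak.linter.dupNamespace); `Summit.Langlands.Langlands` is the mandated namespace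

namespace Summit.Langlands.Langlands.Theorems.QuarterDeficit1951

open Summit.Langlands.Langlands.Theses.QuarterDeficit1951

/-- **Assembly of route QuarterDeficit1951** (item stmt-Langlands-15900).
`QuarterFingerprintDeficit → CorrespondentFingerprint → IcosahedralSupply → ¬ Langlands`:
unfold `Assembly`; the three hypotheses were exactly those of the route's deciding theorem
`Summit.Langlands.Langlands.Theses.QuarterDeficit1951.closes` (whose conclusion is `¬ Langlands`)
until its re-cut; since then the proof is that theorem's Step 2, inlined.
[folklore] -/
theorem Assembly_proof : Summit.Langlands.Langlands.Theses.QuarterDeficit1951.Assembly := by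
  unfold Summit.Langlands.Langlands.Theses.QuarterDeficit1951.Assembly
  intro hDeficit hFingerprint hSupply hL
  -- buildfix 2026-08-20 (proof only; statement byte-identical): `closes` was re-cut to take the census
  -- inputs (CensusDeficit1951, WindowFormDictionary, CensusDecoding) and DERIVE the window deficit as
  -- its Step 1; the frame keeps `QuarterFingerprintDeficit` itself, so the proof is Step 2 of `closes`
  -- verbatim (route file `Theses/QuarterDeficit1951.lean`), started at `hDeficit`.
  obtain ⟨⟨RD⟩, hRD⟩ := hL ℚ
  haveI : Fact (Nat.Prime 17) := ⟨by norm_num⟩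
  obtain ⟨ι, ρ, hgeo, hyp⟩ := hSupply RD 17 le_rfl
  have hB := (hRD RD 2 (by norm_num)
    (Literature.NumberTheory.Automorphic.isCompact_glFiniteIntegralLevel_holds 2 ℚ)).2
  obtain ⟨π, hLalg, hcorr⟩ := hB 17 ι ρ hyp.1 hgeo
  obtain ⟨χ, hχ, u, hform, hne, hfp⟩ := hFingerprint RD 17 ι _ π ρ le_rfl (by norm_num) hyp hLalg hcorr
  refine hDeficit χ hχ ⟨u, 1 / 4, hform, hne, by norm_num, fun p hp => ?_⟩
  obtain ⟨μ, φ, hφ, hT, hμ⟩ := hfp p hp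
  exact ⟨μ, φ, hφ, hT, by rw [hμ, sub_self, norm_zero]; norm_num⟩

end Summit.Langlands.Langlands.Theorems.QuarterDeficit1951
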